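import Mathlib
import HarnessLib
import Literature.Analysis.FluidPDE.ClassicalSolution
import Literature.Analysis.FluidPDE.SpaceTimeCalculusC1
import Literature.Analysis.FluidPDE.ClassicalSolutionCalculus
import Summits.NavierStokesRegularity.NavierStokesRegularity.Theses.EfficiencyFloor
import Summits.NavierStokesRegularity.NavierStokesRegularity.Theorems.EfficiencyFloorEnstrophyBudget
import Summits.NavierStokesRegularity.NavierStokesRegularity.Theorems.StretchingWellBindingEnstrophyQuarterLawLambSlavingSlice
import Summits.NavierStokesRegularity.NavierStokesRegularity.Theorems.StretchingWellBindingEnstrophyQuarterLawLambSlavingTonelli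
import Summits.NavierStokesRegularity.NavierStokesRegularity.Theorems.StretchingWellBindingEnstrophyQuarterLawFastSetBudget

/-!
# Shelf 1574, line `lamb_budget`: THE ENGINE — `EnstrophySlavedToIntenseLamb` (stub 1)

Helper file (`--supports stmt-NavierStokesRegularity-1574 --as helper`; director KEY-NS #114 (2)). Stub 1 of
ns-idea-9's LINE 7 `Cruxes/EnstrophyQuarterLaw/Lines/lamb_budget.lean`, signature VERBATIM with the Cruxes-local
predicates (`IntenseLambLaw`, `intenseLambBudget`, `fastSet`, `SliceLaw`) unfolded: for every `c₀ ∈ (0,1)` and every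
maximal classical Leray–Hopf solution from a rapidly decaying datum, the super-threshold Lamb-budget law
`𝔏_{c₀}(t) = ∫₀ᵗ∫_{F(s)} |curl u × u|² ≤ K/√(T−t)` implies the slice quarter law `∫|curl u(t)|² ≤ K'/√(T−t)`.

PROOF. Along the solution `dZ/dt = 2S − 2νP` (tree: `EfficiencyFloor.EnstrophyBudget`, item 22995, PROVED), and
at each time the fixed-time slaving inequality `2S − 2νP ≤ (c₀²/(2(T−s)))Z + Λ(s)/(2ν)`
(`LambBudget.slaving_slice`). With `a = c₀²/2 < 1/2` the integrating factor `W = (T−s)^a Z` has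
`W' ≤ (T−s)^a Λ(s)/(2ν)`, so `W(t) − W(T/2) ≤ ∫ (T−s)^aΛ/(2ν)` (the derivative-comparison form of FTC,
`sub_le_integral_of_hasDeriv_right_of_le`, needs no integrability of `W'`), and Tonelli against the cumulative
budget (`LambBudget.lintegral_rpow_weight_le`) gives `∫_{T/2}^{t}(T−s)^aΛ ≤ K(T−t)^{a−1/2}/(1−2a)`; hence
`Z(t) ≤ [(T/2)^a Z(T/2) T^{1/2−a} + K/(2ν(1−c₀²))]/√(T−t)` on `[T/2, T)`, and Tao's class bounds `Z` on `[0, T/2]`.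

HONEST FRAMING: bookkeeping about ONE hypothetical blow-up; nothing here bears on the regularity problem;
`EnstrophyQuarterLaw` (1574), the Type-I wall (0056) and `VolumeSparsenessLaw` stay OPEN. No summit statement is
proved.
-/

noncomputable section

-- the summit-side namespace repeats a component by design (D-0017)
set_option linter.dupNamespace false

namespace Summit.NavierStokesRegularity.NavierStokesRegularity.Theorems.EnstrophyQuarterLaw.LambBudget

open Set MeasureTheory Function Metric Filter Topology
open scoped ENNReal NNReal RealInnerProductSpace
open Literature.Analysis.FluidPDE

variable {ν T : ℝ} {u : ℝ → EuclideanSpace ℝ (Fin 3) → EuclideanSpace ℝ (Fin 3)}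
  {p : ℝ → EuclideanSpace ℝ (Fin 3) → ℝ}

/-! ### Measurability of the super-threshold Lamb energy in time -/

/-- The super-threshold Lamb energy `s ↦ ∫_{ {|u(s)| > c₀√(ν/(T−s))} } |curl u(s) × u(s)|²` of a classical
solution is a.e.-measurable on every `(t₀, t)` with `0 ≤ t₀`, `t < T` (the integrand is the indicator of a
relatively open set times a continuous function on the slab; Tonelli measurability). [folklore] -/
theorem aemeasurable_lambEnergy (hT : 0 < T) (hsol : IsClassicalNSSolutionOn (Ico 0 T) ν 0 u p) (c₀ : ℝ)
    {t₀ t : ℝ} (ht₀ : 0 ≤ t₀) (htT : t < T) :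
    AEMeasurable (fun s => ∫⁻ x in {x : EuclideanSpace ℝ (Fin 3) | c₀ * Real.sqrt (ν / (T - s)) < ‖u s x‖},
      ‖cross (curl (u s) x) (u s x)‖ₑ ^ 2) (volume.restrict (Ioo t₀ t)) := by
  have _ := hT
  have hu_cont : ContinuousOn (uncurry u) (Ico 0 T ×ˢ (univ : Set (EuclideanSpace ℝ (Fin 3)))) :=
    hsol.smooth_velocity.continuousOn
  have hDu_cont : ContinuousOn (fun q : ℝ × EuclideanSpace ℝ (Fin 3) => fderiv ℝ (u q.1) q.2)
      (Ico 0 T ×ˢ (univ : Set (EuclideanSpace ℝ (Fin 3)))) :=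
    continuousOn_fderiv_slice_of_contDiffOn (hsol.smooth_velocity.of_le (by norm_cast)) (uniqueDiffOn_Ico 0 T)
  set S : Set (ℝ × EuclideanSpace ℝ (Fin 3)) := Ioo t₀ t ×ˢ univ with hS
  have hS_open : IsOpen S := isOpen_Ioo.prod isOpen_univ
  have hS_sub : S ⊆ Ico 0 T ×ˢ (univ : Set (EuclideanSpace ℝ (Fin 3))) :=
    prod_mono (fun s hs => ⟨ht₀.trans hs.1.le, hs.2.trans htT⟩) Subset.rfl
  have hIcc_sub : Icc t₀ t ×ˢ (univ : Set (EuclideanSpace ℝ (Fin 3))) ⊆ Ico 0 T ×ˢ univ :=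
    prod_mono (fun s hs => ⟨ht₀.trans hs.1, lt_of_le_of_lt hs.2 htT⟩) Subset.rfl
  -- the Lamb vector is continuous on the closed slab
  have hG : ContinuousOn (fun q : ℝ × EuclideanSpace ℝ (Fin 3) => cross (curl (u q.1) q.2) (u q.1 q.2))
      (Icc t₀ t ×ˢ univ) := by
    have h1' : ContinuousOn (fun q : ℝ × EuclideanSpace ℝ (Fin 3) => curlCLM (fderiv ℝ (u q.1) q.2))
        (Icc t₀ t ×ˢ univ) := curlCLM.continuous.comp_continuousOn (hDu_cont.mono hIcc_sub)
    have h1 : ContinuousOn (fun q : ℝ × EuclideanSpace ℝ (Fin 3) => curl (u q.1) q.2) (Icc t₀ t ×ˢ univ) :=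
      h1'.congr fun q _ => curl_eq_curlCLM _ _
    have h2 : ContinuousOn (fun q : ℝ × EuclideanSpace ℝ (Fin 3) => u q.1 q.2) (Icc t₀ t ×ˢ univ) :=
      hu_cont.mono hIcc_sub
    have hf : ContinuousOn (fun q : ℝ × EuclideanSpace ℝ (Fin 3) => crossCLM (curl (u q.1) q.2))
        (Icc t₀ t ×ˢ univ) := crossCLM.continuous.comp_continuousOn h1
    have h3 : ContinuousOn (fun q : ℝ × EuclideanSpace ℝ (Fin 3) => crossCLM (curl (u q.1) q.2) (u q.1 q.2))
        (Icc t₀ t ×ˢ univ) := hf.clm_apply h2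
    refine h3.congr fun q _ => ?_
    exact (crossCLM_apply _ _).symm
  have hh : AEMeasurable (fun q : ℝ × EuclideanSpace ℝ (Fin 3) => ‖cross (curl (u q.1) q.2) (u q.1 q.2)‖ₑ ^ 2)
      ((volume.restrict (Ioo t₀ t)).prod volume) :=
    ((aestronglyMeasurable_prod_of_continuousOn hG).aemeasurable.enorm.pow_const 2)
  -- the super-level set is relatively open in the open slab
  set A : Set (ℝ × EuclideanSpace ℝ (Fin 3)) :=
    S ∩ (fun q : ℝ × EuclideanSpace ℝ (Fin 3) => ‖u q.1 q.2‖ - c₀ * Real.sqrt (ν / (T - q.1))) ⁻¹' Ioi 0 with hA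
  have hψ : ContinuousOn (fun q : ℝ × EuclideanSpace ℝ (Fin 3) => ‖u q.1 q.2‖ - c₀ * Real.sqrt (ν / (T - q.1))) S := by
    refine ((hu_cont.mono hS_sub).norm).sub (continuousOn_const.mul ?_)
    refine ((continuousOn_const.div (continuousOn_const.sub continuousOn_fst) fun q hq => ?_).sqrt)
    have hq1 : q.1 < T := (show q.1 ∈ Ioo t₀ t from hq.1).2.trans htT
    exact (sub_pos.2 hq1).ne'
  have hA_open : IsOpen A := hψ.isOpen_inter_preimage hS_open isOpen_Ioi
  have hH := (hh.indicator hA_open.measurableSet).lintegral_prod_right'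
  refine hH.congr ((ae_restrict_mem measurableSet_Ioo).mono fun s hs => ?_)
  have hsI : s ∈ Ico 0 T := ⟨ht₀.trans hs.1.le, hs.2.trans htT⟩
  have hsc : Continuous (u s) := (hsol.contDiff_velocity hsI).continuous
  have hFs : MeasurableSet {x : EuclideanSpace ℝ (Fin 3) | c₀ * Real.sqrt (ν / (T - s)) < ‖u s x‖} :=
    (isOpen_lt continuous_const hsc.norm).measurableSet
  show (∫⁻ x, A.indicator (fun q : ℝ × EuclideanSpace ℝ (Fin 3) =>
      ‖cross (curl (u q.1) q.2) (u q.1 q.2)‖ₑ ^ 2) (s, x)) =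
    ∫⁻ x in {x : EuclideanSpace ℝ (Fin 3) | c₀ * Real.sqrt (ν / (T - s)) < ‖u s x‖},
      ‖cross (curl (u s) x) (u s x)‖ₑ ^ 2
  rw [← lintegral_indicator hFs]
  refine lintegral_congr fun x => ?_
  simp only [indicator, hA, hS, mem_inter_iff, mem_prod, mem_univ, and_true, mem_preimage, mem_Ioi, sub_pos,
    mem_setOf_eq, hs, true_and]


/-! ### Stub 1: the enstrophy is slaved to the super-threshold Lamb budget -/

/-- **`EnstrophySlavedToIntenseLamb` of `Lines/lamb_budget.lean` (stub 1 — the line's engine — signature VERBATIM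
with the Cruxes-local predicates unfolded).** For every threshold `c₀ ∈ (0,1)` and every maximal classical
Leray–Hopf solution from a rapidly decaying datum, the super-threshold Lamb-budget quarter law
`∫₀ᵗ∫_{ {|u(s)|>c₀√(ν/(T−s))} } |curl u × u|² ≤ K/√(T−t)` on `[0,T)` implies the slice quarter law
`∫|curl u(t)|² ≤ K'/√(T−t)` on `[0,T)`. (Enstrophy budget `Z' = 2S − 2νP`, fixed-time slaving
`2S − 2νP ≤ (c₀²/(2(T−s)))Z + Λ/(2ν)`, integrating factor `(T−s)^{c₀²/2}`, derivative-comparison FTC, Tonelli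
against the cumulative budget; Tao's class on `[0, T/2]`.) [folklore] -/
theorem enstrophySlavedToIntenseLamb :
    ∀ c₀ : ℝ, 0 < c₀ → c₀ < 1 →
    ∀ (ν T : ℝ), 0 < ν → 0 < T →
      ∀ (u : ℝ → EuclideanSpace ℝ (Fin 3) → EuclideanSpace ℝ (Fin 3)) (p : ℝ → EuclideanSpace ℝ (Fin 3) → ℝ),
      IsMaximalSmoothSolution ν 0 u p T → IsLerayHopfOn T ν 0 (u 0) u → HasRapidSpatialDecay (u 0) →
      (∃ K : ℝ, ∀ t ∈ Set.Ico 0 T,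
        (∫⁻ s in Set.Ioo 0 t, ∫⁻ x in {x : EuclideanSpace ℝ (Fin 3) | c₀ * Real.sqrt (ν / (T - s)) < ‖u s x‖},
          ‖cross (curl (u s) x) (u s x)‖ₑ ^ 2) ≤ ENNReal.ofReal (K / Real.sqrt (T - t))) →
      ∃ K : ℝ, ∀ t ∈ Set.Ico 0 T, ∫⁻ x, ‖curl (u t) x‖ₑ ^ 2 ≤ ENNReal.ofReal (K / Real.sqrt (T - t)) := by
  intro c₀ hc₀ hc₁ ν T hν hT u p hmax hLH hdec hbudget
  obtain ⟨K₀, hK₀⟩ := hbudget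
  have hsol : IsClassicalNSSolutionOn (Ico 0 T) ν 0 u p := hmax.1
  -- the super-threshold Lamb energy of a slice
  set Λ : ℝ → ℝ≥0∞ := fun s =>
    ∫⁻ x in {x : EuclideanSpace ℝ (Fin 3) | c₀ * Real.sqrt (ν / (T - s)) < ‖u s x‖},
      ‖cross (curl (u s) x) (u s x)‖ₑ ^ 2 with hΛdef
  -- a non-negative budget constant
  set K : ℝ := max K₀ 0 with hKdef
  have hK0 : 0 ≤ K := le_max_right _ _
  have hK : ∀ t ∈ Ico 0 T, ∫⁻ s in Ioo 0 t, Λ s ≤ ENNReal.ofReal (K / Real.sqrt (T - t)) := fun t ht =>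
    (hK₀ t ht).trans (ENNReal.ofReal_le_ofReal
      (div_le_div_of_nonneg_right (le_max_left _ _) (Real.sqrt_nonneg _)))
  -- the exponent `a = c₀²/2 ∈ (0, 1/2)`
  set a : ℝ := c₀ ^ 2 / 2 with ha
  have ha0 : 0 < a := by positivity
  have hc2 : c₀ ^ 2 < 1 := by nlinarith
  have ha12 : a < 1 / 2 := by rw [ha]; linarith
  have h12a : 0 < 1 - 2 * a := by linarith
  -- ### the enstrophy budget along the solution (item 22995, PROVED in the tree)
  have hEB0 := Summit.NavierStokesRegularity.NavierStokesRegularity.Theorems.efficiencyFloor_enstrophyBudget_proof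
  unfold Summit.NavierStokesRegularity.NavierStokesRegularity.Theses.EfficiencyFloor.EnstrophyBudget at hEB0
  obtain ⟨c, -, hEB⟩ := hEB0
  obtain ⟨Zr, Pr, Sr, hZPS⟩ := hEB ν T hν hT u p hmax hLH hdec
  -- `Zr s` is the real enstrophy
  have hZr_eq : ∀ s ∈ Ioo 0 T, Zr s = ∫ x, ‖curl (u s) x‖ ^ 2 := by
    intro s hs
    obtain ⟨hZ, hZ0, -, -, -, -, -⟩ := hZPS s hs
    have hsI : s ∈ Ico 0 T := ⟨hs.1.le, hs.2⟩
    have hωc : Continuous (curl (u s)) :=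
      continuous_curl ((hsol.contDiff_velocity hsI).of_le (by norm_cast))
    have hfin : ∫⁻ x, ‖curl (u s) x‖ₑ ^ 2 < ⊤ := by rw [hZ]; exact ENNReal.ofReal_lt_top
    have hint : Integrable (fun x => ‖curl (u s) x‖ ^ 2) := integrable_sq_norm_of_lintegral_lt_top hωc hfin
    have h1 : ∫⁻ x, ‖curl (u s) x‖ₑ ^ 2 = ENNReal.ofReal (∫ x, ‖curl (u s) x‖ ^ 2) := by
      rw [ofReal_integral_eq_lintegral_ofReal hint (Eventually.of_forall fun x => sq_nonneg _)]
      exact lintegral_congr fun x => by rw [← ofReal_norm, ENNReal.ofReal_pow (norm_nonneg _)]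
    rw [hZ] at h1
    exact (ENNReal.ofReal_eq_ofReal_iff hZ0 (integral_nonneg fun x => sq_nonneg _)).1 h1
  -- ### the derivative bound from the fixed-time slaving inequality
  have hD : ∀ s ∈ Ioo 0 T, Λ s < ⊤ ∧
      2 * Sr s - 2 * ν * Pr s ≤ a / (T - s) * Zr s + (2 * ν)⁻¹ * (Λ s).toReal := by
    intro s hs
    have hsI : s ∈ Ico 0 T := ⟨hs.1.le, hs.2⟩
    obtain ⟨-, -, -, hP, hS, -, -⟩ := hZPS s hs
    obtain ⟨hfin, hle⟩ := slaving_slice hν hT hsol hLH hdec hc₀ hsI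
    refine ⟨hfin, ?_⟩
    have hTs : 0 < T - s := sub_pos.2 hs.2
    have e : c₀ ^ 2 / (2 * (T - s)) = a / (T - s) := by rw [ha]; field_simp
    rw [hS, hP, hZr_eq s hs, ← e]
    exact hle
  -- ### the integrating factor `W = (T - s)^a Z`
  set W : ℝ → ℝ := fun s => (T - s) ^ a * Zr s with hW
  have hWderiv : ∀ s ∈ Ioo 0 T, HasDerivAt W
      (-1 * a * (T - s) ^ (a - 1) * Zr s + (T - s) ^ a * (2 * Sr s - 2 * ν * Pr s)) s := by
    intro s hs
    obtain ⟨-, -, -, -, -, hZ', -⟩ := hZPS s hs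
    have hTs : 0 < T - s := sub_pos.2 hs.2
    have h1 : HasDerivAt (fun r => T - r) (-1) s := by
      simpa using (hasDerivAt_id s).const_sub T
    have h2 : HasDerivAt (fun r => (T - r) ^ a) (-1 * a * (T - s) ^ (a - 1)) s :=
      h1.rpow_const (p := a) (Or.inl hTs.ne')
    exact h2.mul hZ'
  have hWbound : ∀ s ∈ Ioo 0 T,
      -1 * a * (T - s) ^ (a - 1) * Zr s + (T - s) ^ a * (2 * Sr s - 2 * ν * Pr s) ≤
        (T - s) ^ a / (2 * ν) * (Λ s).toReal := by
    intro s hs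
    have hTs : 0 < T - s := sub_pos.2 hs.2
    obtain ⟨-, hle⟩ := hD s hs
    have hpow : 0 ≤ (T - s) ^ a := Real.rpow_nonneg hTs.le _
    have h1 : (T - s) ^ a * (2 * Sr s - 2 * ν * Pr s) ≤
        (T - s) ^ a * (a / (T - s) * Zr s + (2 * ν)⁻¹ * (Λ s).toReal) :=
      mul_le_mul_of_nonneg_left hle hpow
    have h2 : (T - s) ^ a * (a / (T - s)) = a * (T - s) ^ (a - 1) := by
      rw [Real.rpow_sub_one hTs.ne']
      field_simp
    calc -1 * a * (T - s) ^ (a - 1) * Zr s + (T - s) ^ a * (2 * Sr s - 2 * ν * Pr s)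
        ≤ -1 * a * (T - s) ^ (a - 1) * Zr s +
            (T - s) ^ a * (a / (T - s) * Zr s + (2 * ν)⁻¹ * (Λ s).toReal) := by linarith
      _ = -1 * a * (T - s) ^ (a - 1) * Zr s + ((T - s) ^ a * (a / (T - s))) * Zr s +
            (T - s) ^ a * ((2 * ν)⁻¹ * (Λ s).toReal) := by ring
      _ = (T - s) ^ a / (2 * ν) * (Λ s).toReal := by rw [h2]; ring
  -- ### the early slab `[0, T/2]` (Tao's class)
  set t₀ : ℝ := T / 2 with ht₀
  have ht₀I : t₀ ∈ Ioo 0 T := ⟨by rw [ht₀]; positivity, by rw [ht₀]; linarith⟩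
  set κ : ℝ := ‖(Literature.Analysis.FluidPDE.curlCLM :
    (EuclideanSpace ℝ (Fin 3) →L[ℝ] EuclideanSpace ℝ (Fin 3)) →L[ℝ] EuclideanSpace ℝ (Fin 3))‖ with hκ
  have hcl0 : IsClassicalNSSolutionOn (Icc 0 t₀) ν 0 u p :=
    hsol.mono (Icc_subset_Ico_right ht₀I.2) (uniqueDiffOn_Icc ht₀I.1)
  have hEn0 : ∃ C : ℝ≥0∞, C < ⊤ ∧ ∀ t ∈ Icc 0 t₀, ∫⁻ x, ‖u t x‖ₑ ^ 2 ≤ C :=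
    ⟨ENNReal.ofReal (2 * VectorCalculus.kineticEnergy (u 0)), ENNReal.ofReal_lt_top, fun t ht =>
      hLH.lintegral_enorm_sq_le hν.le ⟨ht.1, ht.2.trans ht₀I.2.le⟩⟩
  have hH0 : HasBoundedSobolevNormsOn (Icc 0 t₀) u :=
    (tao2011_hasBoundedSobolevNormsOn.closedSlab tao2011_hasBoundedSobolevNormsOn_holds
      linfty_bound_of_hasBoundedSobolevNormsOn_holds ν t₀ hν ht₀I.1 u p hcl0 hEn0 hdec).1
  obtain ⟨Cz, hCz⟩ := hH0 1
  set E0 : ℝ≥0∞ := ENNReal.ofReal (κ ^ 2) * Cz with hE0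
  have hE0top : E0 ≠ ⊤ := ENNReal.mul_ne_top ENNReal.ofReal_ne_top ENNReal.coe_ne_top
  have hearly : ∀ t ∈ Icc 0 t₀, ∫⁻ x, ‖curl (u t) x‖ₑ ^ 2 ≤ E0 := fun t ht =>
    (lintegral_curl_sq_le (u t)).trans (mul_le_mul' le_rfl (hCz t ht))
  -- ### the constants
  obtain ⟨-, hZt₀0, -, -, -, -, -⟩ := hZPS t₀ ht₀I
  have hWt₀0 : 0 ≤ W t₀ := mul_nonneg (Real.rpow_nonneg (sub_pos.2 ht₀I.2).le _) hZt₀0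
  set m : ℝ := K / (2 * ν * (1 - 2 * a)) with hm
  have hm0 : 0 ≤ m := by positivity
  set Kfin : ℝ := E0.toReal * Real.sqrt T + W t₀ * T ^ (1 / 2 - a) + m with hKfin
  have hKfin1 : E0.toReal * Real.sqrt T ≤ Kfin := by
    rw [hKfin]
    have : 0 ≤ W t₀ * T ^ (1 / 2 - a) := mul_nonneg hWt₀0 (Real.rpow_nonneg hT.le _)
    linarith
  have hKfin2 : W t₀ * T ^ (1 / 2 - a) + m ≤ Kfin := by
    rw [hKfin]
    have : 0 ≤ E0.toReal * Real.sqrt T := by positivity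
    linarith
  have hKfin0 : 0 ≤ Kfin := le_trans (by positivity) hKfin1
  refine ⟨Kfin, fun t ht => ?_⟩
  have htT : t < T := ht.2
  have hTt : 0 < T - t := sub_pos.2 htT
  have hsT : 0 < Real.sqrt (T - t) := Real.sqrt_pos.2 hTt
  have hsTT : Real.sqrt (T - t) ≤ Real.sqrt T := Real.sqrt_le_sqrt (by linarith [ht.1])
  by_cases hlate : t₀ < t
  · -- ##### late times: the integrating-factor argument on `[T/2, t]`
    -- a slab `[0, t'']` beyond `t` for the bound and the measurability of `Λ`
    set t'' : ℝ := (t + T) / 2 with ht''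
    have htt'' : t < t'' := by rw [ht'']; linarith
    have ht''T : t'' < T := by rw [ht'']; linarith
    have ht''0 : 0 < t'' := lt_trans (lt_of_lt_of_le ht₀I.1 (hlate.le.trans (le_refl t))) htt''
    have hcl'' : IsClassicalNSSolutionOn (Icc 0 t'') ν 0 u p :=
      hsol.mono (Icc_subset_Ico_right ht''T) (uniqueDiffOn_Icc ht''0)
    have hEn'' : ∃ C : ℝ≥0∞, C < ⊤ ∧ ∀ s ∈ Icc 0 t'', ∫⁻ x, ‖u s x‖ₑ ^ 2 ≤ C :=
      ⟨ENNReal.ofReal (2 * VectorCalculus.kineticEnergy (u 0)), ENNReal.ofReal_lt_top, fun s hs =>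
        hLH.lintegral_enorm_sq_le hν.le ⟨hs.1, hs.2.trans ht''T.le⟩⟩
    have hH'' : HasBoundedSobolevNormsOn (Icc 0 t'') u :=
      (tao2011_hasBoundedSobolevNormsOn.closedSlab tao2011_hasBoundedSobolevNormsOn_holds
        linfty_bound_of_hasBoundedSobolevNormsOn_holds ν t'' hν ht''0 u p hcl'' hEn'' hdec).1
    obtain ⟨B₀, hB₀⟩ := linfty_bound_of_hasBoundedSobolevNormsOn_holds
      (fun s hs => (hcl''.contDiff_velocity hs).of_le (by norm_cast)) hH''
    obtain ⟨C₁, hC₁⟩ := hH'' 1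
    set Λmax : ℝ≥0∞ := (ENNReal.ofReal (κ ^ 2) * C₁) * ENNReal.ofReal (B₀ ^ 2) with hΛmax
    have hΛmax_top : Λmax ≠ ⊤ :=
      ENNReal.mul_ne_top (ENNReal.mul_ne_top ENNReal.ofReal_ne_top ENNReal.coe_ne_top) ENNReal.ofReal_ne_top
    have hΛle : ∀ s ∈ Icc 0 t'', Λ s ≤ Λmax := by
      intro s hs
      calc Λ s ≤ ∫⁻ x in {x : EuclideanSpace ℝ (Fin 3) | c₀ * Real.sqrt (ν / (T - s)) < ‖u s x‖},
            ‖curl (u s) x‖ₑ ^ 2 * ENNReal.ofReal (B₀ ^ 2) :=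
            lintegral_mono fun x => (enorm_cross_sq_le _ _).trans
              (mul_le_mul' le_rfl (enorm_sq_le_ofReal_sq (hB₀ s hs x)))
        _ ≤ ∫⁻ x, ‖curl (u s) x‖ₑ ^ 2 * ENNReal.ofReal (B₀ ^ 2) := setLIntegral_le_lintegral _ _
        _ = (∫⁻ x, ‖curl (u s) x‖ₑ ^ 2) * ENNReal.ofReal (B₀ ^ 2) :=
            lintegral_mul_const' _ _ ENNReal.ofReal_ne_top
        _ ≤ (ENNReal.ofReal (κ ^ 2) * C₁) * ENNReal.ofReal (B₀ ^ 2) :=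
            mul_le_mul' ((lintegral_curl_sq_le (u s)).trans (mul_le_mul' le_rfl (hC₁ s hs))) le_rfl
    -- measurability of `Λ` on `(t₀, t)`
    have hΛm : AEMeasurable Λ (volume.restrict (Ioo t₀ t)) :=
      aemeasurable_lambEnergy hT hsol c₀ ht₀I.1.le htT
    -- the majorant `φ = (T - s)^a Λ / (2ν)` of `W'` and its integrability on `[t₀, t]`
    set φ : ℝ → ℝ := fun s => (T - s) ^ a / (2 * ν) * (Λ s).toReal with hφ
    have hwm : Measurable fun s : ℝ => (T - s) ^ a / (2 * ν) :=
      ((measurable_const.sub measurable_id).pow_const a).div_const _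
    have hφm_Ioo : AEStronglyMeasurable φ (volume.restrict (Ioo t₀ t)) :=
      (hwm.aemeasurable.mul hΛm.ennreal_toReal).aestronglyMeasurable
    have hφm : AEStronglyMeasurable φ (volume.restrict (Icc t₀ t)) := by
      rw [← Measure.restrict_congr_set Ioo_ae_eq_Icc]; exact hφm_Ioo
    have hφ0 : ∀ s, s < T → 0 ≤ φ s := fun s hs =>
      mul_nonneg (div_nonneg (Real.rpow_nonneg (sub_pos.2 hs).le _) (by positivity)) ENNReal.toReal_nonneg
    have hφ_bd : ∀ s ∈ Icc t₀ t, ‖φ s‖ ≤ T ^ a / (2 * ν) * Λmax.toReal := by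
      intro s hs
      have hsT' : s < T := lt_of_le_of_lt hs.2 htT
      rw [Real.norm_of_nonneg (hφ0 s hsT')]
      refine mul_le_mul ?_ (ENNReal.toReal_mono hΛmax_top (hΛle s ⟨ht₀I.1.le.trans hs.1, hs.2.trans htt''.le⟩))
        ENNReal.toReal_nonneg (by positivity)
      exact div_le_div_of_nonneg_right
        (Real.rpow_le_rpow (sub_pos.2 hsT').le (by linarith [hs.1, ht₀I.1]) ha0.le) (by positivity)
    have hφint : IntegrableOn φ (Icc t₀ t) volume :=
      ⟨hφm, HasFiniteIntegral.of_bounded ((ae_restrict_mem measurableSet_Icc).mono hφ_bd)⟩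
    -- the derivative-comparison form of the fundamental theorem of calculus
    have hWcont : ContinuousOn W (Icc t₀ t) := fun s hs =>
      (hWderiv s ⟨ht₀I.1.trans_le hs.1, lt_of_le_of_lt hs.2 htT⟩).continuousAt.continuousWithinAt
    have hmain : W t - W t₀ ≤ ∫ s in t₀..t, φ s :=
      intervalIntegral.sub_le_integral_of_hasDeriv_right_of_le hlate.le hWcont
        (fun s hs => (hWderiv s ⟨ht₀I.1.trans hs.1, hs.2.trans htT⟩).hasDerivWithinAt) hφint
        (fun s hs => hWbound s ⟨ht₀I.1.trans hs.1, hs.2.trans htT⟩)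
    -- the majorant's integral, through Tonelli against the cumulative budget
    have hcum : ∀ r ∈ Icc t₀ t, ∫⁻ s in Ioo t₀ r, Λ s ≤ ENNReal.ofReal (K / Real.sqrt (T - r)) :=
      fun r hr => (lintegral_mono_set (Ioo_subset_Ioo_left ht₀I.1.le)).trans
        (hK r ⟨ht₀I.1.le.trans hr.1, lt_of_le_of_lt hr.2 htT⟩)
    have hTon := lintegral_rpow_weight_le ha0 ha12 hlate.le htT hK0 hΛm hcum
    have hlin : ∫⁻ s in Ioo t₀ t, ENNReal.ofReal (φ s) ≤
        ENNReal.ofReal ((2 * ν)⁻¹) * ENNReal.ofReal (K * (T - t) ^ (a - 1 / 2) / (1 - 2 * a)) := by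
      calc ∫⁻ s in Ioo t₀ t, ENNReal.ofReal (φ s)
          ≤ ∫⁻ s in Ioo t₀ t, ENNReal.ofReal ((2 * ν)⁻¹) * (ENNReal.ofReal ((T - s) ^ a) * Λ s) := by
            refine setLIntegral_mono_ae' measurableSet_Ioo (ae_of_all _ fun s hs => ?_)
            have hTs : 0 < T - s := by linarith [hs.2]
            show ENNReal.ofReal ((T - s) ^ a / (2 * ν) * (Λ s).toReal) ≤ _
            rw [show (T - s) ^ a / (2 * ν) * (Λ s).toReal = (2 * ν)⁻¹ * ((T - s) ^ a * (Λ s).toReal) by ring,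
              ENNReal.ofReal_mul (by positivity), ENNReal.ofReal_mul (Real.rpow_nonneg hTs.le _)]
            exact mul_le_mul' le_rfl (mul_le_mul' le_rfl ENNReal.ofReal_toReal_le)
        _ = ENNReal.ofReal ((2 * ν)⁻¹) * ∫⁻ s in Ioo t₀ t, ENNReal.ofReal ((T - s) ^ a) * Λ s :=
            lintegral_const_mul' _ _ ENNReal.ofReal_ne_top
        _ ≤ _ := mul_le_mul' le_rfl hTon
    have hx0 : 0 ≤ (T - t) ^ (a - 1 / 2) := Real.rpow_nonneg hTt.le _
    have hR0 : 0 ≤ K * (T - t) ^ (a - 1 / 2) / (1 - 2 * a) := div_nonneg (mul_nonneg hK0 hx0) h12a.le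
    have hWle : W t - W t₀ ≤ (2 * ν)⁻¹ * (K * (T - t) ^ (a - 1 / 2) / (1 - 2 * a)) := by
      refine hmain.trans ?_
      rw [intervalIntegral.integral_of_le hlate.le, integral_Ioc_eq_integral_Ioo,
        integral_eq_lintegral_of_nonneg_ae ((ae_restrict_mem measurableSet_Ioo).mono fun s hs =>
          hφ0 s (hs.2.trans htT)) hφm_Ioo]
      have h1 := ENNReal.toReal_mono (ENNReal.mul_ne_top ENNReal.ofReal_ne_top ENNReal.ofReal_ne_top) hlin
      rwa [ENNReal.toReal_mul, ENNReal.toReal_ofReal (by positivity), ENNReal.toReal_ofReal hR0] at h1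
    -- unpack `W` and conclude
    obtain ⟨hZt, hZt0, -, -, -, -, -⟩ := hZPS t ⟨ht₀I.1.trans hlate, htT⟩
    rw [hZt]
    refine ENNReal.ofReal_le_ofReal ?_
    have hxa : 0 < (T - t) ^ a := Real.rpow_pos_of_pos hTt _
    have hZr : Zr t = (T - t) ^ (-a) * W t := by
      show Zr t = (T - t) ^ (-a) * ((T - t) ^ a * Zr t)
      rw [← mul_assoc, ← Real.rpow_add hTt, neg_add_cancel, Real.rpow_zero, one_mul]
    have hWt : W t ≤ W t₀ + m * (T - t) ^ (a - 1 / 2) := by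
      have e : (2 * ν)⁻¹ * (K * (T - t) ^ (a - 1 / 2) / (1 - 2 * a)) = m * (T - t) ^ (a - 1 / 2) := by
        rw [hm]; field_simp
      linarith [hWle, e.le, e.ge]
    have hna : 0 ≤ (T - t) ^ (-a) := Real.rpow_nonneg hTt.le _
    have e1 : (T - t) ^ (-a) * (T - t) ^ (a - 1 / 2) = (T - t) ^ (-(1 / 2 : ℝ)) := by
      rw [← Real.rpow_add hTt]; congr 1; ring
    have e2 : (T - t) ^ (-a) = (T - t) ^ (1 / 2 - a) * (T - t) ^ (-(1 / 2 : ℝ)) := by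
      rw [← Real.rpow_add hTt]; congr 1; ring
    have e3 : Kfin / Real.sqrt (T - t) = Kfin * (T - t) ^ (-(1 / 2 : ℝ)) := by
      rw [Real.sqrt_eq_rpow, div_eq_mul_inv, Real.rpow_neg hTt.le]
    have hTpow : (T - t) ^ (1 / 2 - a) ≤ T ^ (1 / 2 - a) :=
      Real.rpow_le_rpow hTt.le (by linarith [ht.1]) (by linarith)
    have hhalf : 0 ≤ (T - t) ^ (-(1 / 2 : ℝ)) := Real.rpow_nonneg hTt.le _
    calc Zr t = (T - t) ^ (-a) * W t := hZr
      _ ≤ (T - t) ^ (-a) * (W t₀ + m * (T - t) ^ (a - 1 / 2)) := mul_le_mul_of_nonneg_left hWt hna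
      _ = W t₀ * ((T - t) ^ (1 / 2 - a) * (T - t) ^ (-(1 / 2 : ℝ))) +
            m * ((T - t) ^ (-a) * (T - t) ^ (a - 1 / 2)) := by rw [← e2]; ring
      _ = (W t₀ * (T - t) ^ (1 / 2 - a) + m) * (T - t) ^ (-(1 / 2 : ℝ)) := by rw [e1]; ring
      _ ≤ (W t₀ * T ^ (1 / 2 - a) + m) * (T - t) ^ (-(1 / 2 : ℝ)) := by
          refine mul_le_mul_of_nonneg_right ?_ hhalf
          exact add_le_add (mul_le_mul_of_nonneg_left hTpow hWt₀0) le_rfl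
      _ ≤ Kfin * (T - t) ^ (-(1 / 2 : ℝ)) := mul_le_mul_of_nonneg_right hKfin2 hhalf
      _ = Kfin / Real.sqrt (T - t) := e3.symm
  · -- ##### early times `t ≤ T/2`: Tao's class
    have htI : t ∈ Icc 0 t₀ := ⟨ht.1, not_lt.1 hlate⟩
    calc ∫⁻ x, ‖curl (u t) x‖ₑ ^ 2 ≤ E0 := hearly t htI
      _ = ENNReal.ofReal E0.toReal := (ENNReal.ofReal_toReal hE0top).symm
      _ ≤ ENNReal.ofReal (Kfin / Real.sqrt (T - t)) := by
          refine ENNReal.ofReal_le_ofReal ?_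
          rw [le_div_iff₀ hsT]
          calc E0.toReal * Real.sqrt (T - t) ≤ E0.toReal * Real.sqrt T :=
                mul_le_mul_of_nonneg_left hsTT ENNReal.toReal_nonneg
            _ ≤ Kfin := hKfin1

end Summit.NavierStokesRegularity.NavierStokesRegularity.Theorems.EnstrophyQuarterLaw.LambBudget

end
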